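import Summits.CriticalPhenomena.PercolationContinuityZ3.Theorems.PercNearOneGluingNoHeavyLowerTailSunflowerC1FastCensus
import HarnessLib

/-!
# `NoHeavyLowerTail` (crux stmt-CriticalPhenomena-4575), abstract sunflower cubic: four-coin census, CHUNK 1/6 — all sunflowers of
# up-sets on four coins whose core has `0 ≤ #core < 4` points pass the fast canonical-splitting check (compiled, `native_decide`)

Support file (seat `prim-ineq-gen-2` gen 33; `--supports stmt-CriticalPhenomena-4575`; computational).  Assembled in …SunflowerC1FourCoins.
-/

namespace Summit.CriticalPhenomena.PercolationContinuityZ3.Theorems.SunflowerPartition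

namespace SafeCalc

namespace C1Cert

/-- **Chunk 1 of the four-coin census**: every sunflower triple `(V₀, V₁, V₂)` of up-sets on `Fin 4` with pairwise intersections of
size in `[0, 4)` and `key V₀ ≤ key V₁ ≤ key V₂` passes `checkFast`. (Compiled evaluation.) [this work] -/
theorem fourCoins_chunk_0_4 : allSunTestCard 4 0 4 = true := by
  native_decide

end C1Cert

end SafeCalc

end Summit.CriticalPhenomena.PercolationContinuityZ3.Theorems.SunflowerPartition
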